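/-
Copyright (c) 2026 The HodgeCM formalization project (cell hodgecm-mathlib, squad K2·E4). Prover seat hodgecm-mathlib-K2E4-p10 (g4).
Released under Apache 2.0 license as described in the file LICENSE.
-/
import Summits.HodgeConjecture.HodgeConjecture.Theorems.K2E1MaassSelbergPoleControlSphericalCMTwo              -- ★ p858276 (this seat): ED. (A) `poleControl_sphericalEisenstein_cm_two` (survivors `hdec′`∕`hdecU`)
import Summits.HodgeConjecture.HodgeConjecture.Theorems.K2E1EisensteinMinusConstantTermBoundedLevelCMTwoUniform  -- ★ (R3u)₂ p858054 (K2-defs1 g4): the z-uniform cusp bound `…_uniform_of_archSmooth`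
import Summits.HodgeConjecture.HodgeConjecture.Theorems.K2E1HeightLineArchSmoothUniformU2                        -- ★ (q11)₂ p858256 (this seat): `exists_archSmooth_flatSectionU_const_cm_two_uniform`
import Summits.HodgeConjecture.HodgeConjecture.Theorems.K2E1BorelEisensteinGodementU2                            -- ★ `flatSectionU_borel_mul_two` (flat sections are Borel sections, K2Liu currency)
import Summits.HodgeConjecture.HodgeConjecture.Theorems.K2E1MaassSelbergPoleControlSphericalCMThreeArch          -- ★ p858259 (K2E4-p11 g4): `isUnitary_one` (rank-free; reused, not restated)
import HarnessLib

/-!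
# K2·E1 — `K2E1MaassSelbergPoleControlSphericalCMTwoArch`: POLE CONTROL AT THE SPHERICAL VECTOR OF `U(1,1)` OVER A CM FIELD ON `{Re z > 1, Im z ≠ 0}`, EDITION (B) —
# the decay survivors `hdec′` ∕ `hdecU` of ★ p858276 DISCHARGED; SURVIVORS: NOTHING NAMED (campaign «EIS-RANK-ONE», rung R6h, milestone «POLE-CONTROL-2-SPH»)

Track B ∕ K2-LIT, crux h413 = `stmt-HodgeConjecture-24833`, route of record `HCCMUnconditional`; cell `hodgecm-mathlib`, squad K2, ENGINE E1.  Prover seat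
`hodgecm-mathlib-K2E4-p10` (g4); DEAL «POLE-CONTROL-2 SPH (B) Arch» of the dealer K2E1-plan (g4) 2026-09-04T07:24:33Z, mirroring ★ p858259
`K2E1MaassSelbergPoleControlSphericalCMThreeArch` (K2E4-p11 (g4)) one rank down.  THEOREMS ONLY (no `def`, no `instance`, no notation, no named-fact hypothesis, no `sorry`);
lane `--supports stmt-HodgeConjecture-24833 --as helper` (count-neutral).  Closes no socket.

THE STEP ED. (A) → ED. (B) [MoeglinWaldspurger1995, I.2.10–I.2.12, II.1.5–II.1.7, IV.2.3, IV.3.12 (a); Arthur1980TraceFormulaII, §4; Garrett2018, §1.12, §2.2, §2.9, §11.3].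
★ p858276 `poleControl_sphericalEisenstein_cm_two` controls the spherical `c`-function of `U(1,1)` on the Godement half-plane `Re z > 1` (off the real axis) modulo the decay of
`E(φ₀H^{z′}) − E(φ₀H^{z′})_B` on `{H > T}`, pointwise on the sub-tube `1 < Re z′ < Re z` (`hdec′`) and locally uniformly at `z` (`hdecU`).  Both are instances of ★ (R3u)₂
`exists_bound_sub_borelConstantTerm_level_cm_two_uniform_of_archSmooth` at the constant section `φ ≡ φ₀` on a compact `Kc ⊂ {1 < Re}`: `Kc = {z′}` for `hdec′` and
`Kc = closedBall z r`, `r = (Re z − 1)∕2`, for `hdecU` (§2).  Its binders at `φ ≡ φ₀`: the section law `hf` is the Borel law of `φ₀·H^z` for the TRIVIAL Hecke character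
(§1, ★ `flatSectionU_borel_mul_two`; `χ = 1` is unitary, ★ `isUnitary_one`), `hφc hφM hφB hφU` are trivial, the level is `U₀ = GL₂(𝒪̂_L)` (★ `isOpen_glFiniteIntegralLevel`), and
the archimedean symbol binder `hφarch` along the `U(J₂)` line `a ↦ f_z(ι(w₀)·n(θ(a, b))·k)` is ★ (q11)₂ `exists_archSmooth_flatSectionU_const_cm_two_uniform` on `‖z′‖ ≤ R ⊇ Kc`
(ONE `C_φ`).  At `N = 2` the unipotent radical is abelian: there is NO E-layer (no centre average, no `hφarchZ`), so NOTHING NAMED survives.  The auxiliary Borel structures and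
additive Haar measures on `𝔸_L`, `𝔸_{L⁺}`, `𝔸_{L⁺,∞}`, `𝔸_{L⁺,f}` demanded by ★ (R3u)₂ are chosen inside the proofs (`borel _`, `Measure.addHaar`); the two line-chart side
conditions `hij`, `hN` of ★ (R3u)₂ ∕ ★ (q11)₂ are `rfl`.  The letters `δ ∈ L⁻ ∖ 0` (trace-zero line chart) and `m > [L⁺:ℚ]` (archimedean order) are free parameters of the head.
* §1 `flatSectionU_const_borel_mul_two` — `f_z(b g) = (1 u)·‖u‖^z·f_z(g)` for `b₁₀ = 0`, `u = b₀₀`, `f_z = φ₀·H^z`.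
* §2 `exists_bound_sub_borelConstantTerm_sphericalEisenstein_cm_two` — `∃ M₁, ∀ w ∈ Kc, ∀ g, T < H g → ‖E(φ₀H^w) g − E(φ₀H^w)_B g‖ ≤ M₁` for compact `Kc ⊂ {1 < Re} ∩ closedBall 0 R`.
* §3 HEAD **`poleControl_sphericalEisenstein_cm_two_of_archSmooth`** — ★ p858276's (a1) ∧ (a2) ∧ (a3) (`a = κ_ℝ·m·‖φ₀‖²`, `b = κ_ℝ·m·‖c(z)‖²·‖φ₀‖²`, `x = Re z − ½`, `y = Im z`
  EXPLICIT) with NO named survivor: milestone «POLE-CONTROL-2-SPH» unconditional on the Godement range `{Re z > 1, Im z ≠ 0}`.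
HONEST LABEL: HC_CM is proved only modulo the 7 printed citations (2 remaining named inputs: hLiu418 = `stmt-HodgeConjecture-24832`, h413 = `stmt-HodgeConjecture-24833`) until rung 0
closes; this file asserts no named fact and closes no socket.  CEILING NOT CLAIMED (R7₂ ∕ R8: the continuation of `c` to `Re z ≤ 1` and the residue at `z = 1 = 2ρ_H` are not here).
References: [MoeglinWaldspurger1995] I.2.10–I.2.12, II.1.5–II.1.7, IV.2.3, IV.3.12 · [Arthur1980TraceFormulaII] §4 · [Garrett2018] §1.12, §2.2, §2.9, §11.3.
-/

set_option autoImplicit false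
-- the mandated namespace repeats the single-problem summit's segment (`HodgeConjecture.HodgeConjecture`)
set_option linter.dupNamespace false

noncomputable section

open MeasureTheory Measure NumberField IsDedekindDomain Set Filter Topology MulAction Module
-- `Classical` is needed to see the Mathlib normed-space instances on `mixedSpace` (note H5 of `AdelicGLnGlue`)
open scoped ENNReal NNReal ComplexConjugate Classical
open Literature.MeasureTheory.Group Literature.NumberTheory
open Literature.NumberTheory.Automorphic Literature.NumberTheory.Automorphic.UnitaryGroup Literature.NumberTheory.GaloisRepresentations AdelicGroupData
open NumberField.mixedEmbedding
open Summit.HodgeConjecture.HodgeConjecture.Cruxes.H413.K2E1BorelEisensteinU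
open Summit.HodgeConjecture.HodgeConjecture.Cruxes.H413.K2E1MaassSelbergPoleControlSphericalCMTwo
open Summit.HodgeConjecture.HodgeConjecture.Cruxes.H413.K2E1EisensteinMinusConstantTermBoundedLevelCMTwoUniform
open Summit.HodgeConjecture.HodgeConjecture.Cruxes.H413.K2E1HeightLineArchSmoothUniformU2
open Summit.HodgeConjecture.HodgeConjecture.Cruxes.H413.K2E1BorelEisensteinGodementU2 (flatSectionU_borel_mul_two)
open Summit.HodgeConjecture.HodgeConjecture.Cruxes.H413.K2E1MaassSelbergPoleControlSphericalCMThreeArch (isUnitary_one)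

namespace Summit.HodgeConjecture.HodgeConjecture.Cruxes.H413.K2E1MaassSelbergPoleControlSphericalCMTwoArch

variable (L : Type) [Field L] [NumberField L] [IsCMField L]
variable [MeasurableSpace (quasiSplit (↥(maximalRealSubfield L)) L (IsCMField.complexConj L) 2).Adelic] [BorelSpace (quasiSplit (↥(maximalRealSubfield L)) L (IsCMField.complexConj L) 2).Adelic]
variable [MeasurableSpace (AdeleRing (𝓞 L) L)ˣ] [BorelSpace (AdeleRing (𝓞 L) L)ˣ]

/-! ## §1 The constant section is a Borel section for the trivial Hecke character (K2Liu currency `b₁₀ = 0`, `u = b₀₀`) -/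

omit [MeasurableSpace (quasiSplit (↥(maximalRealSubfield L)) L (IsCMField.complexConj L) 2).Adelic] [BorelSpace (quasiSplit (↥(maximalRealSubfield L)) L (IsCMField.complexConj L) 2).Adelic]
  [MeasurableSpace (AdeleRing (𝓞 L) L)ˣ] [BorelSpace (AdeleRing (𝓞 L) L)ˣ] in
/-- **THE CONSTANT SECTION `f_z = φ₀·H^z` OF `U(1,1)` IS A BOREL SECTION OF EXPONENT `z` FOR THE TRIVIAL CHARACTER**: `f_z(b g) = (1 u)·‖u‖^z·f_z(g)` whenever `b₁₀ = 0` and `u = b₀₀`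
(★ `flatSectionU_borel_mul_two` at `χ = 1`, whose hypothesis `φ(b g) = χ(d₀ b)·φ(g)` is `φ₀ = 1·φ₀`). [cite: MoeglinWaldspurger1995, II.1.5] [cite: Garrett2018, §2.2] -/
theorem flatSectionU_const_borel_mul_two (φ₀ z : ℂ) (b g : (quasiSplit (↥(maximalRealSubfield L)) L (IsCMField.complexConj L) 2).Adelic) (u : (AdeleRing (𝓞 L) L)ˣ)
    (h10 : ((b.1 : GL (Fin 2) (AdeleRing (𝓞 L) L)) : Matrix (Fin 2) (Fin 2) (AdeleRing (𝓞 L) L)) 1 0 = 0)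
    (hu : (u : AdeleRing (𝓞 L) L) = ((b.1 : GL (Fin 2) (AdeleRing (𝓞 L) L)) : Matrix (Fin 2) (Fin 2) (AdeleRing (𝓞 L) L)) 0 0) :
    flatSectionU (fun _ : (quasiSplit (↥(maximalRealSubfield L)) L (IsCMField.complexConj L) 2).Adelic => φ₀) z (b * g) = (((1 : HeckeCharacter L) u : ℂˣ) : ℂ) * ((ideleNorm u : ℝ) : ℂ) ^ z * flatSectionU (fun _ : (quasiSplit (↥(maximalRealSubfield L)) L (IsCMField.complexConj L) 2).Adelic => φ₀) z g :=
  flatSectionU_borel_mul_two L (1 : HeckeCharacter L) z (φ := fun _ : (quasiSplit (↥(maximalRealSubfield L)) L (IsCMField.complexConj L) 2).Adelic => φ₀)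
    (fun _ _ hb => by rw [HeckeCharacter.one_apply, Units.val_one, one_mul]) b g u h10 hu

/-! ## §2 The z-uniform cusp bound for the spherical Eisenstein series on a compact `Kc ⊂ {1 < Re}` -/

omit [MeasurableSpace (AdeleRing (𝓞 L) L)ˣ] [BorelSpace (AdeleRing (𝓞 L) L)ˣ] in
/-- **`E(φ₀H^w) − E(φ₀H^w)_B` IS BOUNDED ON `{H > T}` UNIFORMLY FOR `w` IN A COMPACT `Kc ⊂ {1 < Re w}`** (`T ≥ 1`, `m > [L⁺:ℚ]`, `δ ∈ L⁻ ∖ 0`): ★ (R3u)₂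
`exists_bound_sub_borelConstantTerm_level_cm_two_uniform_of_archSmooth` at the constant section `φ ≡ φ₀`, the trivial character (`hf` = §1, ★ `isUnitary_one`), full level
`U₀ = GL₂(𝒪̂_L)` (★ `isOpen_glFiniteIntegralLevel`), and the archimedean binder ★ (q11)₂ `exists_archSmooth_flatSectionU_const_cm_two_uniform` on `‖w‖ ≤ R ⊇ Kc`; the auxiliary
Haar measures on `𝔸_L`, `𝔸_{L⁺}`, `𝔸_{L⁺,∞}`, `𝔸_{L⁺,f}` are chosen inside (no E-layer at `N = 2`). [cite: MoeglinWaldspurger1995, I.2.10–I.2.12, II.1.7] [cite: Garrett2018, §2.9] -/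
theorem exists_bound_sub_borelConstantTerm_sphericalEisenstein_cm_two {δ : L} (hcδ : IsCMField.complexConj L δ = -δ) (hδ : δ ≠ 0)
    (ν : Measure ↥(adelicUnipotent (↥(maximalRealSubfield L)) L (IsCMField.complexConj L) 2)) [ν.IsHaarMeasure]
    {𝓕 : Set ↥(adelicUnipotent (↥(maximalRealSubfield L)) L (IsCMField.complexConj L) 2)} (h𝓕N : IsFundamentalDomain ↥(rationalUnipotent (↥(maximalRealSubfield L)) L (IsCMField.complexConj L) 2) 𝓕 ν) (h𝓕c : IsCompact (closure 𝓕))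
    {m : ℕ} (hm : (finrank ℚ ↥(maximalRealSubfield L) : ℝ) < m) {T : ℝ≥0} (hT : 1 ≤ T) (φ₀ : ℂ)
    {Kc : Set ℂ} (hKc : IsCompact Kc) (hKc1 : ∀ w ∈ Kc, 1 < w.re) {R : ℝ} (hR : ∀ w ∈ Kc, ‖w‖ ≤ R) :
    ∃ M₁ : ℝ, ∀ w ∈ Kc, ∀ g : (quasiSplit (↥(maximalRealSubfield L)) L (IsCMField.complexConj L) 2).Adelic, T < borelHeight g →
      ‖eisensteinSeriesU (flatSectionU (fun _ : (quasiSplit (↥(maximalRealSubfield L)) L (IsCMField.complexConj L) 2).Adelic => φ₀) w) g - borelConstantTerm ν 𝓕 (eisensteinSeriesU (flatSectionU (fun _ : (quasiSplit (↥(maximalRealSubfield L)) L (IsCMField.complexConj L) 2).Adelic => φ₀) w)) g‖ ≤ M₁ := by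
  -- auxiliary Borel structures and additive Haar measures (not in the statement)
  letI : MeasurableSpace (AdeleRing (𝓞 L) L) := borel _
  haveI : BorelSpace (AdeleRing (𝓞 L) L) := ⟨rfl⟩
  letI : MeasurableSpace (AdeleRing (𝓞 ↥(maximalRealSubfield L)) ↥(maximalRealSubfield L)) := borel _
  haveI : BorelSpace (AdeleRing (𝓞 ↥(maximalRealSubfield L)) ↥(maximalRealSubfield L)) := ⟨rfl⟩
  letI : MeasurableSpace (InfiniteAdeleRing ↥(maximalRealSubfield L)) := borel _
  haveI : BorelSpace (InfiniteAdeleRing ↥(maximalRealSubfield L)) := ⟨rfl⟩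
  letI : MeasurableSpace (FiniteAdeleRing (𝓞 ↥(maximalRealSubfield L)) ↥(maximalRealSubfield L)) := borel _
  haveI : BorelSpace (FiniteAdeleRing (𝓞 ↥(maximalRealSubfield L)) ↥(maximalRealSubfield L)) := ⟨rfl⟩
  haveI := locallyCompactSpace_adeleRing' ↥(maximalRealSubfield L)
  haveI := locallyCompactSpace_finiteAdeleRing' ↥(maximalRealSubfield L)
  -- the two `rfl` side conditions of the `U(J₂)` line chart
  have hij : (((0 : Fin 2) : ℕ)) + 1 = ((1 : Fin 2) : ℕ) := rfl
  have hN : 2 = 2 * ((0 : Fin 2) : ℕ) + 2 := rfl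
  -- ONE archimedean constant on `‖w‖ ≤ R ⊇ Kc`
  obtain ⟨Cφ, hCφ, hF⟩ := exists_archSmooth_flatSectionU_const_cm_two_uniform L hij hN hcδ hδ φ₀ m R
  exact exists_bound_sub_borelConstantTerm_level_cm_two_uniform_of_archSmooth L hij hN hcδ hδ ν h𝓕N h𝓕c
    (Measure.addHaar : Measure (AdeleRing (𝓞 ↥(maximalRealSubfield L)) ↥(maximalRealSubfield L)))
    (Measure.addHaar : Measure (InfiniteAdeleRing ↥(maximalRealSubfield L))) (Measure.addHaar : Measure (FiniteAdeleRing (𝓞 ↥(maximalRealSubfield L)) ↥(maximalRealSubfield L)))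
    (1 : HeckeCharacter L) (isUnitary_one L) hKc hKc1 continuous_const (Mφ := ‖φ₀‖) (fun _ => le_rfl) (fun _ _ _ => rfl)
    (fun w _ b g u h10 hu => flatSectionU_const_borel_mul_two L φ₀ w b g u h10 hu) (isOpen_glFiniteIntegralLevel 2 L) le_rfl (fun _ _ _ => rfl) hT hm hCφ
    (fun w hw k hk b => hF w (hR w hw) k hk b)

/-! ## §3 The head: edition (B) of ★ p858276 — no named survivor -/

/-- **POLE CONTROL AT THE SPHERICAL VECTOR OF `U(1,1)` OVER A CM FIELD ON THE GODEMENT HALF-PLANE, EDITION (B) — NOTHING NAMED.**  ★ p858276 `poleControl_sphericalEisenstein_cm_two`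
with its decay survivors `hdec′` (pointwise on the sub-tube `1 < Re z′ < Re z`) and `hdecU` (locally uniform at `z`, on `closedBall z ((Re z − 1)∕2)`) DISCHARGED by §2.  For `Re z > 1`,
`Im z ≠ 0`, `T ≥ 1`, `φ₀ ≠ 0` (and any trace-zero letter `δ ∈ L⁻ ∖ 0`, any archimedean order `m > [L⁺:ℚ]`): (a1) ∧ (a2) ∧ (a3) verbatim ★ p858276, with `a = κ_ℝ·m·‖φ₀‖²`,
`b = κ_ℝ·m·‖c(z)‖²·‖φ₀‖²`, `x = Re z − ½`, `y = Im z` EXPLICIT (`κ_ℝ` Tate's idelic bracket, `m = μ_K(K_U)`, `c(z) = ∫_{N(𝔸)} H(w₀v)^z dν` the spherical `c`-function).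
[cite: MoeglinWaldspurger1995, IV.2.3 and IV.3.12 (a)] [cite: Arthur1980TraceFormulaII, §4] [cite: Garrett2018, §1.12 and §11.3] -/
theorem poleControl_sphericalEisenstein_cm_two_of_archSmooth
    (μ : Measure (quasiSplit (↥(maximalRealSubfield L)) L (IsCMField.complexConj L) 2).automorphicQuotient) [(quasiSplit (↥(maximalRealSubfield L)) L (IsCMField.complexConj L) 2).IsAutomorphicMeasure μ]
    (νG : Measure (quasiSplit (↥(maximalRealSubfield L)) L (IsCMField.complexConj L) 2).Adelic) [νG.IsHaarMeasure] [νG.IsInvInvariant]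
    (μK : Measure ((standardMaximalCompactGL 2 L).comap (adelicVal (↥(maximalRealSubfield L)) L (IsCMField.complexConj L) 2 ((StdForm.antidiagonal 2).over L)) : Subgroup (quasiSplit (↥(maximalRealSubfield L)) L (IsCMField.complexConj L) 2).Adelic))
    [μK.IsHaarMeasure]
    (νI : Measure (AdeleRing (𝓞 L) L)ˣ) [νI.IsHaarMeasure]
    {𝓕I : Set (AdeleRing (𝓞 L) L)ˣ} (h𝓕I : IsIdeleClassDomain L 𝓕I)
    (ν : Measure ↥(adelicUnipotent (↥(maximalRealSubfield L)) L (IsCMField.complexConj L) 2)) [ν.IsHaarMeasure] [ν.IsInvInvariant]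
    {𝓕 : Set ↥(adelicUnipotent (↥(maximalRealSubfield L)) L (IsCMField.complexConj L) 2)} (h𝓕N : IsFundamentalDomain ↥(rationalUnipotent (↥(maximalRealSubfield L)) L (IsCMField.complexConj L) 2) 𝓕 ν) (h𝓕1 : ν 𝓕 = 1) (h𝓕c : IsCompact (closure 𝓕))
    {β : (quasiSplit (↥(maximalRealSubfield L)) L (IsCMField.complexConj L) 2).Adelic → ℝ≥0∞} (hβ : IsCoveringWeight ((arithmeticBorel (↥(maximalRealSubfield L)) L (IsCMField.complexConj L) 2).map (quasiSplit (↥(maximalRealSubfield L)) L (IsCMField.complexConj L) 2).arithmeticSubgroup.subtype) β)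
    {T : ℝ≥0} (hT : 1 ≤ T) {φ₀ : ℂ} (hφ₀ : φ₀ ≠ 0) {z : ℂ} (hz : 1 < z.re) (hy : z.im ≠ 0)
    -- the letters of the discharge: a trace-zero element `δ ∈ L⁻ ∖ 0` (line chart) and an archimedean order `m > [L⁺:ℚ]` — NO named input
    {δ : L} (hcδ : IsCMField.complexConj L δ = -δ) (hδ : δ ≠ 0) {m : ℕ} (hm : (finrank ℚ ↥(maximalRealSubfield L) : ℝ) < m) :
    Real.sqrt ((∫ x in {x : (AdeleRing (𝓞 L) L)ˣ | (IdeleClassGroup.ideleNorm L x : ℝ) ≤ 1} ∩ 𝓕I, (IdeleClassGroup.ideleNorm L x : ℝ) ∂νI) * μK.real Set.univ * ‖(∫ v : ↥(adelicUnipotent (↥(maximalRealSubfield L)) L (IsCMField.complexConj L) 2), (((borelHeight ((quasiSplit (↥(maximalRealSubfield L)) L (IsCMField.complexConj L) 2).toAdelic (weylLongU ((IsCMField.complexConj L : L ≃ₐ[↥(maximalRealSubfield L)] L) : L →+* L) (rfl : (StdForm.antidiagonal 2).over L = (StdForm.antidiagonal 2).over L)) * (v : (quasiSplit (↥(maximalRealSubfield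 L)) L (IsCMField.complexConj L) 2).Adelic))) : ℝ) : ℂ) ^ z ∂ν)‖ ^ 2 * ‖φ₀‖ ^ 2) ≤
        (z.re - 1 / 2) * (T : ℝ) ^ (2 * (z.re - 1 / 2)) * Real.sqrt ((∫ x in {x : (AdeleRing (𝓞 L) L)ˣ | (IdeleClassGroup.ideleNorm L x : ℝ) ≤ 1} ∩ 𝓕I, (IdeleClassGroup.ideleNorm L x : ℝ) ∂νI) * μK.real Set.univ * ‖φ₀‖ ^ 2) / |z.im| +
          Real.sqrt ((z.re - 1 / 2) ^ 2 * (T : ℝ) ^ (4 * (z.re - 1 / 2)) * ((∫ x in {x : (AdeleRing (𝓞 L) L)ˣ | (IdeleClassGroup.ideleNorm L x : ℝ) ≤ 1} ∩ 𝓕I, (IdeleClassGroup.ideleNorm L x : ℝ) ∂νI) * μK.real Set.univ * ‖φ₀‖ ^ 2) / z.im ^ 2 + ((∫ x in {x : (AdeleRing (𝓞 L) L)ˣ | (IdeleClassGroup.ideleNorm L x : ℝ) ≤ 1} ∩ 𝓕I, (IdeleClassGroup.ideleNorm L x : ℝ) ∂νI) * μK.real Set.univ * ‖φ₀‖ ^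 2) * (T : ℝ) ^ (4 * (z.re - 1 / 2))) ∧
      (∀ {x₁ x₂ η : ℝ}, 0 < x₁ → z.re - 1 / 2 ∈ Set.Icc x₁ x₂ → 0 < η → η ≤ |z.im| →
        ((∫ x in {x : (AdeleRing (𝓞 L) L)ˣ | (IdeleClassGroup.ideleNorm L x : ℝ) ≤ 1} ∩ 𝓕I, (IdeleClassGroup.ideleNorm L x : ℝ) ∂νI) * μK.real Set.univ * ‖(∫ v : ↥(adelicUnipotent (↥(maximalRealSubfield L)) L (IsCMField.complexConj L) 2), (((borelHeight ((quasiSplit (↥(maximalRealSubfield L)) L (IsCMField.complexConj L) 2).toAdelic (weylLongU ((IsCMField.complexConj L : L ≃ₐ[↥(maximalRealSubfield L)] L) : L →+* L) (rfl : (StdForm.antidiagonal 2).over L = (StdForm.antidiagonal 2).over L)) * (v : (quasiSplit (↥(maximalRealSubfield L)) L (IsCMField.complexConj L) 2).Adelic))) : ℝ) : ℂ) ^ z ∂ν)‖ ^ 2 * ‖φ₀‖ ^ 2) ≤ (x₂ * (T : ℝ) ^ (2 * x₂) * Real.sqrt ((∫ x in {x : (AdeleRing (𝓞 L) L)ˣ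 | (IdeleClassGroup.ideleNorm L x : ℝ) ≤ 1} ∩ 𝓕I, (IdeleClassGroup.ideleNorm L x : ℝ) ∂νI) * μK.real Set.univ * ‖φ₀‖ ^ 2) / η + Real.sqrt (x₂ ^ 2 * (T : ℝ) ^ (4 * x₂) * ((∫ x in {x : (AdeleRing (𝓞 L) L)ˣ | (IdeleClassGroup.ideleNorm L x : ℝ) ≤ 1} ∩ 𝓕I, (IdeleClassGroup.ideleNorm L x : ℝ) ∂νI) * μK.real Set.univ * ‖φ₀‖ ^ 2) / η ^ 2 + ((∫ x in {x : (AdeleRing (𝓞 L) L)ˣ | (IdeleClassGroup.ideleNorm L x : ℝ) ≤ 1} ∩ 𝓕I, (IdeleClassGroup.ideleNorm L x : ℝ) ∂νI) * μK.real Set.univ * ‖φ₀‖ ^ 2) * (T : ℝ) ^ (4 * x₂))) ^ 2) ∧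
      (|z.im| ≤ 1 → ((∫ x in {x : (AdeleRing (𝓞 L) L)ˣ | (IdeleClassGroup.ideleNorm L x : ℝ) ≤ 1} ∩ 𝓕I, (IdeleClassGroup.ideleNorm L x : ℝ) ∂νI) * μK.real Set.univ * ‖(∫ v : ↥(adelicUnipotent (↥(maximalRealSubfield L)) L (IsCMField.complexConj L) 2), (((borelHeight ((quasiSplit (↥(maximalRealSubfield L)) L (IsCMField.complexConj L) 2).toAdelic (weylLongU ((IsCMField.complexConj L : L ≃ₐ[↥(maximalRealSubfield L)] L) : L →+* L) (rfl : (StdForm.antidiagonal 2).over L = (StdForm.antidiagonal 2).over L)) * (v : (quasiSplit (↥(maximalRealSubfield L)) L (IsCMField.complexConj L) 2).Adelic))) : ℝ) : ℂ) ^ z ∂ν)‖ ^ 2 * ‖φ₀‖ ^ 2) ≤ ((z.re - 1 / 2) * (T : ℝ) ^ (2 * (z.re - 1 / 2)) * Real.sqrt ((∫ x in {x : (AdeleRing (𝓞 L) L)ˣ | (IdeleClassGroup.ideleNorm L x : ℝ) ≤ 1} ∩ 𝓕I, (IdeleClassGroup.ideleNorm L x : ℝ) ∂νI) * μK.real Set.univ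 * ‖φ₀‖ ^ 2) +
        Real.sqrt ((z.re - 1 / 2) ^ 2 * (T : ℝ) ^ (4 * (z.re - 1 / 2)) * ((∫ x in {x : (AdeleRing (𝓞 L) L)ˣ | (IdeleClassGroup.ideleNorm L x : ℝ) ≤ 1} ∩ 𝓕I, (IdeleClassGroup.ideleNorm L x : ℝ) ∂νI) * μK.real Set.univ * ‖φ₀‖ ^ 2) + ((∫ x in {x : (AdeleRing (𝓞 L) L)ˣ | (IdeleClassGroup.ideleNorm L x : ℝ) ≤ 1} ∩ 𝓕I, (IdeleClassGroup.ideleNorm L x : ℝ) ∂νI) * μK.real Set.univ * ‖φ₀‖ ^ 2) * (T : ℝ) ^ (4 * (z.re - 1 / 2)))) ^ 2 / z.im ^ 2) := by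
  -- `hdec′`: pointwise on the sub-tube — the singleton compact
  have hdec' : ∀ z' : ℂ, 1 < z'.re → z'.re < z.re → ∃ M₁' : ℝ, ∀ g : (quasiSplit (↥(maximalRealSubfield L)) L (IsCMField.complexConj L) 2).Adelic, T < borelHeight g →
      ‖eisensteinSeriesU (flatSectionU (fun _ : (quasiSplit (↥(maximalRealSubfield L)) L (IsCMField.complexConj L) 2).Adelic => φ₀) z') g - borelConstantTerm ν 𝓕 (eisensteinSeriesU (flatSectionU (fun _ : (quasiSplit (↥(maximalRealSubfield L)) L (IsCMField.complexConj L) 2).Adelic => φ₀) z')) g‖ ≤ M₁' := by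
    intro z' hz' _
    obtain ⟨M₁', h⟩ := exists_bound_sub_borelConstantTerm_sphericalEisenstein_cm_two L hcδ hδ ν h𝓕N h𝓕c hm hT φ₀ isCompact_singleton
      (fun w hw => by rw [Set.mem_singleton_iff.1 hw]; exact hz') (R := ‖z'‖) (fun w hw => by rw [Set.mem_singleton_iff.1 hw])
    exact ⟨M₁', h z' (Set.mem_singleton z')⟩
  -- `hdecU`: locally uniform at `z` — the closed ball of radius `r = (Re z − 1)∕2` sits in `{1 < Re}` and in `closedBall 0 (‖z‖ + r)`
  have hr : 0 < (z.re - 1) / 2 := by linarith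
  have hball1 : ∀ w ∈ Metric.closedBall z ((z.re - 1) / 2), 1 < w.re := fun w hw => by
    have h1 : |w.re - z.re| ≤ ‖w - z‖ := by simpa only [Complex.sub_re] using Complex.abs_re_le_norm (w - z)
    have h2 : ‖w - z‖ ≤ (z.re - 1) / 2 := mem_closedBall_iff_norm.1 hw
    have h3 := (abs_le.1 (h1.trans h2)).1
    linarith
  have hballR : ∀ w ∈ Metric.closedBall z ((z.re - 1) / 2), ‖w‖ ≤ ‖z‖ + (z.re - 1) / 2 := fun w hw =>
    (norm_le_norm_add_norm_sub' w z).trans (by linarith [mem_closedBall_iff_norm.1 hw])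
  obtain ⟨M₁, hdecU⟩ := exists_bound_sub_borelConstantTerm_sphericalEisenstein_cm_two L hcδ hδ ν h𝓕N h𝓕c hm hT φ₀ (isCompact_closedBall z ((z.re - 1) / 2))
    hball1 hballR
  exact poleControl_sphericalEisenstein_cm_two L μ νG μK νI h𝓕I ν h𝓕N h𝓕1 h𝓕c hβ hT hφ₀ hz hy hdec' (Metric.closedBall_mem_nhds z hr) hdecU

end Summit.HodgeConjecture.HodgeConjecture.Cruxes.H413.K2E1MaassSelbergPoleControlSphericalCMTwoArch

end
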